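/-
Origin: expansion seat `planner-pub-hodgecm-pv06-g4-0`, handover (R)(a) 2026-08-18T08:49:45Z doc-only (`HOME/pub-hodgecm-pv06-g4/replace/HodgeCM/PerL34/Annihilation.lean`, md5 54926b2d, 492 lines);
landed by the gen-7 packager in gate run 27 REPLACES the earlier landed copy of `HodgeCM/PerL34/Annihilation.lean` (seat copy carried the packager origin header of the earlier run (stripped)).
-/
/-
Doc-only v2 (2026-08-18, expansion seat planner-pub-hodgecm-pv06-g4-0, unit pub-hodgecm-pv06-g4; source
`HOME/pub-hodgecm-pv06-g4/replace/HodgeCM/PerL34/Annihilation.lean`): ONE docstring corrected (`AnnihilationDatum.emb_surj`: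
the locator "l. 398: X = the characters χ of [T] with χ_∞ = w" replaced by the actual tex locators ll. 405, 409–410 and the
distinction from the Prop 3.6 hypothesis ll. 399–400), per GAPS adv1 gen 13–16 item (c); every declaration byte-identical to
runs 19–26 (whole-file replacement, module name and imports unchanged, no downstream effect).
-/
/-
Origin: HOME/pub-hodgecm-pv06/lean/Pv06/PerL34/Annihilation.lean — session planner-pub-hodgecm-pv06-0
(unit pub-hodgecm-pv06, DAG-NODE PROVER #06).  Intended final place: `HodgeCM/PerL34/Annihilation.lean`.
DAG node **N23c** (HOME/LEMMAS.md §1): PerL v5 Proposition 3.6, proof Step 2 "annihilation"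
(tex ll. 423–438).  Kind (CONTRIBUTING §3): L2 — honest split with the inference kernel-proved.

WHAT THIS FILE DOES.  The frozen prior interface renders Step 2 as ONE composite field
`TorusData.AX8_annihilation : ∀ v, (∀ χ f, ⟪E χ f, v⟫ = 0) → Pw v = 0` ("disclosed design cut 1" of
`HodgeCM/Prior/Perl34.lean`, consumed by the kernel-checked `C1_prop36` = node N23).  Here that
composite is DISSOLVED: the structure `AnnihilationDatum C D` lists, as separately labelled fields,
exactly the inputs PerL's Step 2 consumes —
* [DEFINITIONAL] the function model: `C([U(W)]) ↪ L²([U(W)])`, right translation, point evaluations,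
  left `U(W)(L₀)`-invariance, and `v_w := ∫_{T(L₀⊗ℝ)} w̄(t) R(t) v dt` (l. 390–391) as a Bochner
  integral against the Haar probability measure of the compact torus;
* [AX12(ii)] the consequence of the second unfolding identity
  `⟨E^χ_f, v⟩ = ∫ f(h) \overline{P_{T,χ̄}(R(h)v)} dh` for all test functions `f` (ll. 423–426):
  `h ↦ P_{T,χ̄}(R(h)v)` vanishes identically;
* [ELEMENTARY] the covariance of the toric period `P_{T,ξ̄}(R(t)x) = ξ_∞(t) P_{T,ξ̄}(x)` (l. 427–429);
* [PRINT] completeness of the characters of the compact abelian group `[T]` (ll. 428–430) and the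
  density of `U(W)(L₀)·T(𝔸)·U(W)(𝔸_f)` in `U(W)(𝔸)` = real approximation, [PR] Thm 7.7,
  [San] Cor 3.5(iii) (ll. 430–433);
* [SETUP D7] approximate identities `R(f_n)v → v` preserving closed invariant subspaces with
  continuous values (l. 423 "smooth vectors are dense in the closed invariant subspace"; print:
  Getz–Hahn, GTM 300 (2024), Prop. 4.2.3, printed p. 76);
and the theorem `AnnihilationDatum.annihilation` KERNEL-PROVES the frozen statement from them.  Proved
on the way (no hypotheses beyond Mathlib): orthogonality of continuous unitary characters of a compact
group (`integral_conj_mul_char`), the Fourier bookkeeping of ll. 426–430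
(`period_proj`, `period_transl_proj_eq_zero`: "P_{T,χ̄}(R(h_f)v) = P_{T,χ̄}(R(h_f)v_{χ_∞})", "the other
isotypic parts integrate to zero against χ", "all Fourier coefficients of (R(h_f)v_w)|_{[T]} vanish"),
the passage `v_w = 0 on a dense set ⇒ v_w = 0 ⇒ (𝓔̄^⊥)_w = 0` (`proj_eq_zero_of_continuous`,
`annihilation`).

Nothing of PerL / QW8 / the 2001 programme is cited; every field is either definitional for the objects
of §3.3, a print fact named with its page, or the set-up datum D7 of LEMMAS.md §3.
-/
import Summits.HodgeConjecture.HodgeCM.Prior.Perl34_5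
import Summits.HodgeConjecture.HodgeCM.PerL34.Isolation
import Mathlib.MeasureTheory.Integral.Bochner.ContinuousLinearMap
import Mathlib.MeasureTheory.Group.Integral
import Mathlib.MeasureTheory.Function.LocallyIntegrable

set_option autoImplicit false

noncomputable section

namespace HodgeCM

namespace PerL34.Annihilation

open HodgeCM.Prior.Perl34File HodgeCM.Prior.Perl34File.Perl34
open MeasureTheory Filter Topology

local notation "⟪" x ", " y "⟫" => @inner ℂ _ _ x y

/-! ## Layer A — character orthogonality on a compact group (pure Mathlib) -/

section LayerA

variable {Tc : Type*} [Group Tc]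

/-- The product `t ↦ conj (w t) * c t` of a conjugated character and a character, as a character. -/
def conjMulChar (w c : Tc →* ℂ) : Tc →* ℂ where
  toFun t := starRingEnd ℂ (w t) * c t
  map_one' := by simp
  map_mul' a b := by
    simp only [map_mul]
    ring

/-- (Ported verbatim from the HodgeCMPerL package; no docstring in the source.) -/
@[simp] theorem conjMulChar_apply (w c : Tc →* ℂ) (t : Tc) :
    conjMulChar w c t = starRingEnd ℂ (w t) * c t := rfl

/-- For a unitary character `w`: `conj (w t) * w t = 1`. -/
theorem conj_mul_self_of_norm_one (w : Tc →* ℂ) (hw : ∀ t, ‖w t‖ = 1) (t : Tc) :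
    starRingEnd ℂ (w t) * w t = 1 := by
  rw [Complex.conj_mul' (w t), hw t]
  simp

/-- **Orthogonality of characters, diagonal case** (probability measure): `∫ conj(w) w dμ = 1` for a
unitary character `w`. -/
theorem integral_conj_mul_char_self [MeasurableSpace Tc] (μ : Measure Tc) [IsProbabilityMeasure μ]
    (w : Tc →* ℂ) (hw : ∀ t, ‖w t‖ = 1) :
    ∫ t, starRingEnd ℂ (w t) * w t ∂μ = 1 := by
  simp_rw [conj_mul_self_of_norm_one w hw]
  simp

variable [TopologicalSpace Tc] [MeasurableSpace Tc] [BorelSpace Tc] [IsTopologicalGroup Tc]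
variable (μ : Measure Tc) [μ.IsMulLeftInvariant]

/-- A character `ψ ≠ 1` of a group integrates to zero against any left-invariant measure
(the integral is translation invariant and gets multiplied by `ψ t₀ ≠ 1`). -/
theorem integral_char_eq_zero (ψ : Tc →* ℂ) (h : ∃ t, ψ t ≠ 1) : ∫ t, ψ t ∂μ = 0 := by
  obtain ⟨t₀, ht₀⟩ := h
  have h1 : ∫ t, ψ (t₀ * t) ∂μ = ∫ t, ψ t ∂μ := integral_mul_left_eq_self _ t₀
  have h2 : ∫ t, ψ (t₀ * t) ∂μ = ψ t₀ * ∫ t, ψ t ∂μ := by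
    simp only [map_mul]
    exact integral_const_mul (ψ t₀) _
  have h3 : (ψ t₀ - 1) * ∫ t, ψ t ∂μ = 0 := by
    rw [sub_mul, one_mul, ← h2, h1, sub_self]
  rcases mul_eq_zero.mp h3 with h | h
  · exact absurd (sub_eq_zero.mp h) ht₀
  · exact h

/-- **Orthogonality of characters, off-diagonal case** (left-invariant measure): `∫ conj(w) c dμ = 0`
for a unitary character `w` and a character `c ≠ w`. -/
theorem integral_conj_mul_char_ne (w c : Tc →* ℂ) (hw : ∀ t, ‖w t‖ = 1) (hc : c ≠ w) :
    ∫ t, starRingEnd ℂ (w t) * c t ∂μ = 0 := by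
  have key : ∫ t, conjMulChar w c t ∂μ = 0 := by
    apply integral_char_eq_zero μ (conjMulChar w c)
    by_contra hall
    apply hc
    ext t
    have h1 : starRingEnd ℂ (w t) * c t = 1 := by
      by_contra hne
      exact hall ⟨t, by simpa using hne⟩
    have h2 : w t * (starRingEnd ℂ (w t) * c t) = w t := by rw [h1, mul_one]
    rw [← mul_assoc, Complex.mul_conj' (w t), hw t] at h2
    simpa using h2
  simpa using key

end LayerA

/-! ## Layer B — the w-isotypic projection as a Bochner integral, and the Fourier bookkeeping -/

section LayerB

variable {Cf : Type*} [NormedAddCommGroup Cf] [NormedSpace ℂ Cf] [CompleteSpace Cf]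
variable {G : Type*} [Group G]
variable {Tc : Type*} [Group Tc] [TopologicalSpace Tc] [MeasurableSpace Tc]
variable [BorelSpace Tc] [IsTopologicalGroup Tc] [CompactSpace Tc]
variable (μ : Measure Tc) [IsProbabilityMeasure μ] [μ.IsMulLeftInvariant]
variable (Rc : G →* (Cf →L[ℂ] Cf)) (ιT : Tc →* G) (w : Tc →* ℂ)

/-- `P x := ∫_{T_c} conj(w t) • R(t) x dμ(t)` — the w-isotypic projection of l. 390–391, on the
continuous model. -/
def proj (x : Cf) : Cf := ∫ t, starRingEnd ℂ (w t) • Rc (ιT t) x ∂μ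

variable {μ Rc ιT w}

omit [CompleteSpace Cf] [IsTopologicalGroup Tc] [μ.IsMulLeftInvariant] in
/-- The integrand of `proj` is integrable (continuous on a compact probability space). -/
theorem integrable_integrand (hw : Continuous w) (hR : ∀ x, Continuous fun t => Rc (ιT t) x)
    (x : Cf) : Integrable (fun t => starRingEnd ℂ (w t) • Rc (ιT t) x) μ := by
  have hc : Continuous fun t => starRingEnd ℂ (w t) • Rc (ιT t) x :=
    (Complex.continuous_conj.comp hw).smul (hR x)
  exact hc.integrable_of_hasCompactSupport (HasCompactSupport.of_compactSpace _)

omit [IsTopologicalGroup Tc] [μ.IsMulLeftInvariant] in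
/-- A bounded operator commuting with the torus translations commutes with `proj`
("R(h_f) commutes with T(L₀⊗ℝ)", l. 426). -/
theorem proj_comm (hw : Continuous w) (hR : ∀ x, Continuous fun t => Rc (ιT t) x)
    (A : Cf →L[ℂ] Cf) (hA : ∀ t x, A (Rc (ιT t) x) = Rc (ιT t) (A x)) (x : Cf) :
    A (proj μ Rc ιT w x) = proj μ Rc ιT w (A x) := by
  unfold proj
  rw [← A.integral_comp_comm (integrable_integrand hw hR x)]
  congr 1
  funext t
  rw [map_smul, hA]

omit [IsTopologicalGroup Tc] [μ.IsMulLeftInvariant] in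
/-- The functional-level form of `proj`: for a continuous linear functional `λ` transforming under
the torus by a character `c`, `λ (proj x) = (∫ conj(w) c dμ) · λ x`. -/
theorem period_proj (hw : Continuous w) (hR : ∀ x, Continuous fun t => Rc (ιT t) x)
    (lam : Cf →L[ℂ] ℂ) (c : Tc →* ℂ) (hlam : ∀ t x, lam (Rc (ιT t) x) = c t * lam x) (x : Cf) :
    lam (proj μ Rc ιT w x) = (∫ t, starRingEnd ℂ (w t) * c t ∂μ) * lam x := by
  unfold proj
  rw [← lam.integral_comp_comm (integrable_integrand hw hR x)]
  have h1 : (fun t => lam (starRingEnd ℂ (w t) • Rc (ιT t) x))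
      = fun t => (starRingEnd ℂ (w t) * c t) * lam x := by
    funext t
    rw [map_smul, hlam, smul_eq_mul, mul_assoc]
  rw [h1, integral_mul_const]

/-- **"(the other T(L₀⊗ℝ)-isotypic parts integrate to zero against χ)"** (ll. 427–429): if `λ`
transforms by a character `c ≠ w`, then `λ ∘ proj = 0`. -/
theorem period_proj_ne (hw : Continuous w) (hwn : ∀ t, ‖w t‖ = 1)
    (hR : ∀ x, Continuous fun t => Rc (ιT t) x)
    (lam : Cf →L[ℂ] ℂ) (c : Tc →* ℂ) (hlam : ∀ t x, lam (Rc (ιT t) x) = c t * lam x)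
    (hc : c ≠ w) (x : Cf) : lam (proj μ Rc ιT w x) = 0 := by
  rw [period_proj hw hR lam c hlam x, integral_conj_mul_char_ne μ w c hwn hc, zero_mul]

omit [IsTopologicalGroup Tc] [μ.IsMulLeftInvariant] in
/-- **"P_{T,χ̄}(R(h_f)v) = P_{T,χ̄}(R(h_f)v_{χ_∞})"** (ll. 426–429), functional-level: if `λ`
transforms by `w` itself, then `λ ∘ proj = λ`. -/
theorem period_proj_self (hw : Continuous w) (hwn : ∀ t, ‖w t‖ = 1)
    (hR : ∀ x, Continuous fun t => Rc (ιT t) x)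
    (lam : Cf →L[ℂ] ℂ) (hlam : ∀ t x, lam (Rc (ιT t) x) = w t * lam x) (x : Cf) :
    lam (proj μ Rc ιT w x) = lam x := by
  rw [period_proj hw hR lam w hlam x, integral_conj_mul_char_self μ w hwn, one_mul]

end LayerB

/-! ## Layer C — the labelled inputs of Step 2 and the kernel-proved annihilation -/

section LayerC

variable {H HG CG G SK SigIdx SigIdxG : Type*}
variable [NormedAddCommGroup H] [InnerProductSpace ℂ H] [CompleteSpace H]
variable [NormedAddCommGroup HG] [InnerProductSpace ℂ HG] [CompleteSpace HG]
variable [NormedAddCommGroup CG] [NormedSpace ℂ CG]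
variable [Group G] [TopologicalSpace G] [TopologicalSpace SK]

/-- **The inputs of PerL v5 Prop 3.6 Step 2** (ll. 423–434) for one torus side `D` over the core `C`,
each a separately labelled field.  Labels: [DEFINITIONAL] = true by the definition of the objects of
§3.3 (functions on `[U(W)] = U(W)(L₀)\U(W)(𝔸)`, right translation, the torus `T(L₀⊗ℝ)`, the
characters of `[T]`, `v_w`); [ELEMENTARY] = a one-line computation from the definitions;
[AX12(ii)] = the second unfolding identity of the pseudo-Eisenstein vectors (ll. 423–426) in the
consequence form Step 2 consumes; [PRINT] = a published theorem, named with its reference;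
[SETUP D7] = LEMMAS.md §3 D7 (smooth vectors / approximate identities). -/
structure AnnihilationDatum (C : IsolationCore H HG CG G SK SigIdx SigIdxG) (D : TorusData C) where
  /-- [DEFINITIONAL] `C([U(W)])` with the sup norm ([U(W)] is compact, l. 384). -/
  Cf : Type
  [instCf₁ : NormedAddCommGroup Cf]
  [instCf₂ : NormedSpace ℂ Cf]
  [instCf₃ : CompleteSpace Cf]
  /-- [DEFINITIONAL] the bounded inclusion `C([U(W)]) ⊆ L²([U(W)])` (finite invariant measure). -/
  j : Cf →L[ℂ] H
  /-- [DEFINITIONAL] right translation `(R(h)x)(g) = x(gh)` on `C([U(W)])` (isometric). -/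
  Rc : G →* (Cf →L[ℂ] Cf)
  /-- [DEFINITIONAL] `R` on `L²` restricts to `R` on `C([U(W)])`. -/
  j_R : ∀ (g : G) (x : Cf), j (Rc g x) = C.R g (j x)
  /-- [DEFINITIONAL] evaluation of a continuous function at the class of `g ∈ U(W)(𝔸)`. -/
  ev : G → (Cf →L[ℂ] ℂ)
  /-- [DEFINITIONAL] `(R(h)x)(g) = x(gh)`. -/
  ev_R : ∀ (g h : G) (x : Cf), ev g (Rc h x) = ev (g * h) x
  /-- [DEFINITIONAL] a continuous function on `[U(W)]` is continuous on `U(W)(𝔸)`. -/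
  ev_cont : ∀ x : Cf, Continuous fun g => ev g x
  /-- [DEFINITIONAL] a function vanishing at every point is zero. -/
  ev_sep : ∀ x : Cf, (∀ g, ev g x = 0) → x = 0
  /-- [DEFINITIONAL] `U(W)(L₀) ⊂ U(W)(𝔸)`. -/
  Γ : Subgroup G
  /-- [DEFINITIONAL] functions on `[U(W)]` are left `U(W)(L₀)`-invariant (l. 430). -/
  ev_left : ∀ γ ∈ Γ, ∀ (g : G) (x : Cf), ev (γ * g) x = ev g x
  /-- [DEFINITIONAL] the compact torus `T(L₀⊗ℝ) ≅ U(1)^{2[L₀:ℚ]}` (l. 387). -/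
  Tc : Type
  [instTc₁ : Group Tc]
  [instTc₂ : TopologicalSpace Tc]
  [instTc₃ : IsTopologicalGroup Tc]
  [instTc₄ : CompactSpace Tc]
  [instTc₅ : MeasurableSpace Tc]
  [instTc₆ : BorelSpace Tc]
  /-- [DEFINITIONAL] the Haar probability measure `dt` on `T(L₀⊗ℝ)` (l. 390). -/
  μ : Measure Tc
  [instμ₁ : IsProbabilityMeasure μ]
  [instμ₂ : μ.IsMulLeftInvariant]
  /-- [DEFINITIONAL] `T(L₀⊗ℝ) ⊂ U(W)(L₀⊗ℝ) ⊂ U(W)(𝔸)`. -/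
  ιT : Tc →* G
  /-- [DEFINITIONAL] the archimedean type `w`, a continuous unitary character of `T(L₀⊗ℝ)`
  (ll. 387–388). -/
  w : Tc →* ℂ
  w_cont : Continuous w
  w_norm : ∀ t, ‖w t‖ = 1
  /-- [DEFINITIONAL] `t ↦ R(t)x` is sup-norm continuous for `x ∈ C([U(W)])` (uniform continuity on
  the compact `[U(W)]`). -/
  Rc_cont : ∀ x : Cf, Continuous fun t => Rc (ιT t) x
  /-- [DEFINITIONAL] `v_w := ∫_{T(L₀⊗ℝ)} \overline{w(t)} R(t)v dt` (l. 390–391) and "P_w denotes the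
  orthogonal projection onto E_w" (l. 391): the frozen `Pw` IS this Bochner integral. -/
  Pw_def : ∀ v : H, D.Pw v = ∫ t, starRingEnd ℂ (w t) • C.R (ιT t) v ∂μ
  /-- [DEFINITIONAL] the set of ALL continuous characters of the compact abelian group `[T]`. -/
  Xall : Type
  /-- [DEFINITIONAL] the frozen `D.X` is the subset of characters of archimedean type `w`
  (ll. 398–400, 409). -/
  emb : D.X → Xall
  /-- [DEFINITIONAL] the archimedean component `ξ_∞ := ξ ∘ (T(L₀⊗ℝ) → [T])` of a character of `[T]`
  ("T(L₀⊗ℝ) → [T] is injective since T is anisotropic", l. 387–388). -/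
  χinf : Xall → (Tc →* ℂ)
  /-- [DEFINITIONAL] every character `ξ` of `[T]` with `ξ_∞ = w` belongs to the frozen index set `D.X`: in
  Step 2 the pseudo-Eisenstein series `E^χ_f` are indexed by ALL characters `χ` of `[T]` with `χ_∞ = w` (proof of
  Prop 3.6, l. 405 "For a character χ of [T] with χ_∞ = w" and ll. 409–410 "f and χ varying, χ_∞ = w").  NOT the
  hypothesis of Prop 3.6 (ll. 399–400: every such `χ` "arises from an allowed pair", = Lemma 4.2(b)), which Step 2
  does not use.  (Doc-only v2: the run-19 text attributed a sentence "X = the characters χ of [T] with χ_∞ = w" to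
  l. 398; the tex has no such sentence — l. 398 defines `w` — GAPS adv1g13 (xxxi) ff. / adv1g16 (c).) -/
  emb_surj : ∀ ξ : Xall, χinf ξ = w → ∃ χ : D.X, emb χ = ξ
  /-- [DEFINITIONAL] the toric period / Fourier coefficient `P_{T,ξ̄}(x) = ∫_{[T]} x(t) \overline{ξ(t)} dt`
  of a continuous function along the compact `[T] ⊂ [U(W)]` (ll. 424–427), a sup-norm continuous
  linear functional. -/
  PT : Xall → (Cf →L[ℂ] ℂ)
  /-- [ELEMENTARY] covariance of the toric period under `T(L₀⊗ℝ)`: substituting `t' ↦ t't⁻¹` in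
  `∫_{[T]} x(t't) \overline{ξ(t')} dt'` gives `ξ_∞(t) P_{T,ξ̄}(x)` (used at ll. 427–429). -/
  PT_cov : ∀ (ξ : Xall) (t : Tc) (x : Cf), PT ξ (Rc (ιT t) x) = χinf ξ t * PT ξ x
  /-- [DEFINITIONAL] `U(W)(𝔸_f)`. -/
  Gf : Type
  [instGf : Group Gf]
  /-- [DEFINITIONAL] `U(W)(𝔸_f) ⊂ U(W)(𝔸)`. -/
  ιf : Gf →* G
  /-- [DEFINITIONAL] `U(W)(𝔸_f)` and `T(L₀⊗ℝ) ⊂ U(W)(L₀⊗ℝ)` commute in `U(W)(𝔸)` (l. 426: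
  "R(h_f) commutes with T(L₀⊗ℝ)"). -/
  comm : ∀ (hf : Gf) (t : Tc), ιf hf * ιT t = ιT t * ιf hf
  /-- [AX12(ii)] (ll. 423–426) "0 = ⟨E^χ_f, v⟩ = ∫_{U(W)(𝔸)} f(h) \overline{P_{T,χ̄}(R(h)v)} dh for all
  f, so the continuous function h ↦ P_{T,χ̄}(R(h)v) vanishes identically" — the second unfolding
  identity of the pseudo-Eisenstein vectors together with the fundamental lemma of the calculus of
  variations (f ranges over all test functions), in the consequence form Step 2 consumes. -/
  unfold : ∀ (x : Cf) (χ : D.X), (∀ f, ⟪D.E χ f, j x⟫ = 0) → ∀ h : G, PT (emb χ) (Rc h x) = 0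
  /-- [DEFINITIONAL] `T(𝔸)`. -/
  TA : Type
  /-- [DEFINITIONAL] `T(𝔸) ⊂ U(W)(𝔸)`. -/
  ιA : TA → G
  /-- [PRINT] completeness of the characters of the compact abelian group `[T]`: the characters form an
  orthonormal basis of `L²([T])` and the trigonometric polynomials are dense in `C([T])`
  (Stone–Weierstrass + Pontryagin–van Kampen point separation; held page: Garling, *Inequalities: A
  Journey into Linear Analysis* (CUP 2007), Thm 9.5.1 and its proof, p. 145; also Hewitt–Ross I 22.17,
  Folland, *A Course in Abstract Harmonic Analysis*, Cor. 4.26), so a continuous function on `[T]` all of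
  whose Fourier coefficients vanish is zero — applied to `x|_{[T]}`, whose value at the class of
  `t ∈ T(𝔸)` is `x(t)` (ll. 428–430). -/
  fourier : ∀ x : Cf, (∀ ξ : Xall, PT ξ x = 0) → ∀ t : TA, ev (ιA t) x = 0
  /-- [PRINT] real approximation ([PR] = Platonov–Rapinchuk, *Algebraic Groups and Number Theory*
  (1994), Thm 7.7, p. 415: `G(K)` is dense in `G(K ⊗_ℚ ℝ)` for a connected `K`-group `G` — applied to
  the connected reductive `U(W)` over `L₀`; [San] Cor 3.5(iii); secondary held page hit:
  arXiv:1003.3804 p. 9 quoting "[PR] Theorem 7.7, p. 415"), whence (ll. 430–433: "given (x_∞,x_f) …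
  (γ, γ·γ⁻¹x_f) lies in the set") `U(W)(L₀)·T(𝔸)·U(W)(𝔸_f)` is dense in `U(W)(𝔸)`. -/
  dense : Dense {g : G | ∃ γ ∈ Γ, ∃ (t : TA) (hf : Gf), g = γ * ιA t * ιf hf}
  /-- [SETUP D7] an approximate identity `(f_n)` in `C_c^∞(U(W)(𝔸))`, through the operators
  `R(f_n)` (l. 392–393; print: Getz–Hahn, GTM 300 (2024), §4.2). -/
  sm : ℕ → (H →L[ℂ] H)
  /-- [SETUP D7] `R(f_n)v → v` (Getz–Hahn Prop. 4.2.3, printed p. 76). -/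
  sm_tendsto : ∀ v : H, Tendsto (fun n => sm n v) atTop (𝓝 v)
  /-- [SETUP D7] `R(f_n)` preserves every closed `R(U(W)(𝔸))`-invariant subspace (a Bochner integral
  of an `M`-valued function lies in the closed subspace `M`). -/
  sm_mem : ∀ (M : Submodule ℂ H), IsClosed (M : Set H) → C.Invariant M →
    ∀ (n : ℕ), ∀ v ∈ M, sm n v ∈ M
  /-- [SETUP D7] `R(f_n)v` is a smooth, in particular continuous, function on `[U(W)]`
  (l. 423: "Let v ∈ 𝓔̄^⊥ be a smooth vector (smooth vectors are dense …)"). -/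
  sm_cont : ∀ (n : ℕ) (v : H), ∃ x : Cf, j x = sm n v

attribute [instance] AnnihilationDatum.instCf₁ AnnihilationDatum.instCf₂ AnnihilationDatum.instCf₃
  AnnihilationDatum.instTc₁ AnnihilationDatum.instTc₂ AnnihilationDatum.instTc₃
  AnnihilationDatum.instTc₄ AnnihilationDatum.instTc₅ AnnihilationDatum.instTc₆
  AnnihilationDatum.instμ₁ AnnihilationDatum.instμ₂ AnnihilationDatum.instGf

namespace AnnihilationDatum

variable {C : IsolationCore H HG CG G SK SigIdx SigIdxG} {D : TorusData C}
variable (A : AnnihilationDatum C D)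

/-- `P_w` on the continuous model: `Pc x := ∫ conj(w t) • R(t) x dt ∈ C([U(W)])`. -/
def Pc (x : A.Cf) : A.Cf := proj A.μ A.Rc A.ιT A.w x

/-- The frozen `Pw` restricted to continuous vectors is `Pc` (l. 390–391): `P_w (j x) = j (Pc x)`. -/
theorem Pw_j (x : A.Cf) : D.Pw (A.j x) = A.j (A.Pc x) := by
  rw [A.Pw_def, Pc, proj, ← A.j.integral_comp_comm (integrable_integrand A.w_cont A.Rc_cont x)]
  congr 1
  funext t
  rw [map_smul, A.j_R]

/-- `R(h_f)` commutes with `Pc` (l. 426). -/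
theorem Rc_Pc (hf : A.Gf) (x : A.Cf) : A.Rc (A.ιf hf) (A.Pc x) = A.Pc (A.Rc (A.ιf hf) x) := by
  refine proj_comm A.w_cont A.Rc_cont (A.Rc (A.ιf hf)) ?_ x
  intro t y
  rw [← mul_apply_eq_comp, ← map_mul, A.comm, map_mul, mul_apply_eq_comp]

/-- **"Hence all Fourier coefficients of (R(h_f)v_w)|_{[T]} vanish: those with χ_∞ = w by the
above, the others trivially"** (ll. 426–430), for a continuous `x` orthogonal to every `E^χ_f`. -/
theorem period_transl_Pc_eq_zero (x : A.Cf) (hx : ∀ χ f, ⟪D.E χ f, A.j x⟫ = 0) (ξ : A.Xall)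
    (hf : A.Gf) : A.PT ξ (A.Rc (A.ιf hf) (A.Pc x)) = 0 := by
  rw [A.Rc_Pc]
  by_cases hξ : A.χinf ξ = A.w
  · obtain ⟨χ, hχ⟩ := A.emb_surj ξ hξ
    have hcov : ∀ (t : A.Tc) (y : A.Cf), A.PT ξ (A.Rc (A.ιT t) y) = A.w t * A.PT ξ y := by
      intro t y
      rw [A.PT_cov, hξ]
    rw [Pc, period_proj_self A.w_cont A.w_norm A.Rc_cont (A.PT ξ) hcov, ← hχ]
    exact A.unfold x χ (hx χ) (A.ιf hf)
  · rw [Pc, period_proj_ne A.w_cont A.w_norm A.Rc_cont (A.PT ξ) (A.χinf ξ) (A.PT_cov ξ) hξ]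

/-- **"So v_w(th_f) = 0 for all t in the image of T(𝔸) and all h_f; as v_w is left
U(W)(L₀)-invariant, v_w vanishes on U(W)(L₀)T(𝔸)U(W)(𝔸_f).  This set is dense … Thus v_w = 0"**
(ll. 430–434), for a continuous `x` orthogonal to every `E^χ_f`. -/
theorem Pc_eq_zero (x : A.Cf) (hx : ∀ χ f, ⟪D.E χ f, A.j x⟫ = 0) : A.Pc x = 0 := by
  apply A.ev_sep
  have hS : ∀ g ∈ {g : G | ∃ γ ∈ A.Γ, ∃ (t : A.TA) (hf : A.Gf), g = γ * A.ιA t * A.ιf hf},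
      A.ev g (A.Pc x) = 0 := by
    rintro g ⟨γ, hγ, t, hf, rfl⟩
    rw [mul_assoc, A.ev_left γ hγ, ← A.ev_R]
    exact A.fourier _ (fun ξ => A.period_transl_Pc_eq_zero x hx ξ hf) t
  have hclosed : IsClosed {g : G | A.ev g (A.Pc x) = 0} :=
    isClosed_eq (A.ev_cont (A.Pc x)) continuous_const
  have hsub : closure {g : G | ∃ γ ∈ A.Γ, ∃ (t : A.TA) (hf : A.Gf), g = γ * A.ιA t * A.ιf hf}
      ⊆ {g : G | A.ev g (A.Pc x) = 0} := hclosed.closure_subset_iff.mpr hS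
  intro g
  exact hsub (A.dense.closure_eq ▸ Set.mem_univ g)


-- port_pkg: scope closed for this part
end AnnihilationDatum
end LayerC
end PerL34.Annihilation
end HodgeCM
end
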